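import Literature.NumberTheory.Rogawski1990.ArchimedeanTransfer                  -- ★ `ArchSmooth₂`, `endoEmbArch`, `isClosedEmbedding_endoEmbArch`
import Literature.NumberTheory.Automorphic.CuspFormArchConvolution              -- ★ smooth-`GL_n(K_∞)` kit: `continuous_of_isArchSmooth_gl`, `isArchSmooth_comp_inv_gl`, `isArchSmooth∕hasCompactSupport_iterLieDeriv_glInf`
import Literature.NumberTheory.Automorphic.ArchSchwartzSpace                    -- ★ p848256 (LH3-p03, deal #3): `archHSGL`, `archTwoSidedDerivGL`, `ArchSchwartzGL`, `ArchSchwartzOn` (ED. 3 by-name heads)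
import HarnessLib

/-!
# Two-sided word derivatives of archimedean test functions are bounded against every continuous weight
# (`C_c^∞(H_∞) ⊂ 𝒞(H_∞)`, the easy inclusion of the Harish-Chandra Schwartz space; Beuzart-Plessis 2020, §1.5)

Topic `NumberTheory/Rogawski1990`; namespace `Literature.NumberTheory.Rogawski1990`.  THEOREMS ONLY (no `def`, no instance, no notation, no axiom,
no named fact, no `sorry`).  Cell `pub/hodgecm-mathlib`, crux H413 (`stmt-HodgeConjecture-24833`), F0∕P3c line LH3 (closer stub `stub_N9` = the archimedean
endoscopic transfer on `C_c^∞`), seat LH3-p04 (g0); organ-adjacent lemma (S1) dealt by LH3-plan (g0) 2026-09-02T02:20:12Z for the pay-down skeleton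
`StubN9.paydown.skeleton.v1` (D1 = the Harish-Chandra Schwartz class `𝒞(H_∞)` typed through `ι_∞ : H_∞ ↪ GL₃(L ⊗ ℝ)`), stated here OVER THE BODIES of the
skeleton's §0 so that it lands before the Lines leaf does.

THE MATHEMATICS.  [BeuzartPlessis2020Asterisque, §1.5 p. 31]: the Harish-Chandra Schwartz space `𝒞(G(ℝ))` is the space of `f ∈ C^∞(G(ℝ))` with
`sup_g |(R(u)L(v)f)(g)| Ξ^G(g)⁻¹ σ(g)^d < ∞` for all `d` and all `u, v ∈ U(𝔤)`; it contains `C_c^∞(G(ℝ))` because every `R(u)L(v)f` is again smooth and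
compactly supported, hence bounded against any continuous weight.  We prove exactly this for the tree's test functions:
* §1 (`GL_n(K_∞)`, any number field `K`): for `α : GL_n(K ⊗ ℝ) → ℂ` right-smooth (★ `IsArchSmooth` for ★ `archGroupGL n K`) the two-sided word derivative
  `x ↦ (R(u) (R(v)α)ˇ)(x⁻¹)` (`ψˇ(y) = ψ(y⁻¹)`; left derivatives are right derivatives of the reflection) is continuous (`continuous_twoSidedIterLieDeriv_glInf`),
  and compactly supported when `α` is (`hasCompactSupport_twoSidedIterLieDeriv_glInf`); a continuous compactly supported function pulled back along a closed
  embedding and multiplied by a continuous real weight is bounded (`exists_bound_norm_comp_mul_of_hasCompactSupport`).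
* §2 (`H_∞ = U(Φ₂)(L⁺ ⊗ ℝ) × U(Φ₁)(L⁺ ⊗ ℝ)`, `L` CM): the Hilbert–Schmidt weight `∏_w Σ_{i,j} |(k₂)_{ij,w}|²` of the `U(Φ₂)`-block is continuous and POSITIVE
  (`continuous_archHSWeight`, `archHSWeight_pos`: the `w`-component of `k₂ ∈ GL₂(L ⊗ ℝ)` has a unit determinant), so `√·` and `log` of it are continuous
  (`continuous_archSchwartzWeight`); and for an archimedean test function on the endoscopic side (★ `ArchSmooth₂ L f`: `f = φ ∘ ι_∞`, `φ` continuous, compactly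
  supported, right-smooth on `GL₃(L ⊗ ℝ)`) every two-sided word derivative of `φ` pulled back along `ι_∞` (★ `endoEmbArch`, a closed embedding) is bounded
  against every continuous weight on `H_∞` (`exists_bound_twoSidedIterLieDeriv_endoEmbArch`), in particular against the Schwartz weight
  `(∏_w ‖k_{2,w}‖²_{HS})^{1∕2} (1 + log ∏_w ‖k_{2,w}‖²_{HS})^d` of the skeleton's D1 (`exists_bound_twoSidedIterLieDeriv_endoEmbArch_schwartzWeight`) — which is
  `ArchSmooth₂ L f → ArchSchwartzH L f` with the skeleton's `ArchSchwartzH` unfolded (the restriction to words with letters in `𝔥` is not needed).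
HONEST LABEL: HC_CM is proved only modulo the 7 printed citations (2 remaining: hLiu418 = stmt-HodgeConjecture-24832, h413 = stmt-HodgeConjecture-24833) until
rung 0 closes; this file pays no organ of the stub-N9 skeleton (O1∕O2∕O3 stay open) — it is the D1 non-vacuity ∕ «O1 not stronger than the crux» glue.

## References
* [BeuzartPlessis2020Asterisque] R. Beuzart-Plessis, *A local trace formula for the Gan–Gross–Prasad conjecture for unitary groups: the archimedean case*,
  Astérisque 418 (2020), §1.5 p. 31 (Harish-Chandra Schwartz space, `C_c^∞ ⊂ 𝒞`), Prop. 1.5.1 (i) pp. 29–30.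
* [BorelJacquet1979] A. Borel, H. Jacquet, *Automorphic forms and automorphic representations*, Proc. Sympos. Pure Math. 33 (1979), part 1, §1.5, §4.1.
* [Rogawski1990] J. D. Rogawski, *Automorphic Representations of Unitary Groups in Three Variables*, Ann. of Math. Stud. 123 (1990), §4.9 Prop. 4.9.1 (a) p. 55;
  §14.3 p. 234 («`f′^H_v` of compact support»).
-/

set_option autoImplicit false

noncomputable section

open NumberField NumberField.mixedEmbedding Topology
open Literature.NumberTheory.Automorphic
open scoped MatrixGroups Matrix Classical

namespace Literature.NumberTheory.Rogawski1990

/-! ## §1 Two-sided word derivatives on `GL_n(K_∞)` -/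

section GLn

variable {n : ℕ} {K : Type} [Field K] [NumberField K]

/-- **`x ↦ (R(u)(R(v)α)ˇ)(x⁻¹)` is continuous** for a right-smooth `α` on `GL_n(K ⊗ ℝ)`: `R(v)α` is right-smooth (★ `isArchSmooth_iterLieDeriv_glInf`), so is its
reflection `y ↦ (R(v)α)(y⁻¹)` (★ `isArchSmooth_comp_inv_gl`), so is `R(u)` of that, right-smooth functions on the full linear group are continuous
(★ `continuous_of_isArchSmooth_gl`), and inversion on `GL_n` is continuous. [cite: BorelJacquet1979, §1.5] -/
theorem continuous_twoSidedIterLieDeriv_glInf {α : GL (Fin n) (mixedSpace K) → ℂ}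
    (hα : IsArchSmooth (archGroupGL n K).carrier.subtype α) (u v : List ↥(archGroupGL n K).lie) :
    Continuous fun x : GL (Fin n) (mixedSpace K) =>
      iterLieDeriv (archGroupGL n K).carrier.subtype u
        (fun y : GL (Fin n) (mixedSpace K) => iterLieDeriv (archGroupGL n K).carrier.subtype v α y⁻¹) x⁻¹ := by
  have h1 : IsArchSmooth (archGroupGL n K).carrier.subtype (iterLieDeriv (archGroupGL n K).carrier.subtype v α) :=
    isArchSmooth_iterLieDeriv_glInf hα v
  have h2 : IsArchSmooth (archGroupGL n K).carrier.subtype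
      (fun y : GL (Fin n) (mixedSpace K) => iterLieDeriv (archGroupGL n K).carrier.subtype v α y⁻¹) :=
    isArchSmooth_comp_inv_gl h1
  have h3 : Continuous (iterLieDeriv (archGroupGL n K).carrier.subtype u
      (fun y : GL (Fin n) (mixedSpace K) => iterLieDeriv (archGroupGL n K).carrier.subtype v α y⁻¹)) :=
    continuous_of_isArchSmooth_gl (isArchSmooth_iterLieDeriv_glInf h2 u)
  exact h3.comp continuous_inv

/-- **`x ↦ (R(u)(R(v)α)ˇ)(x⁻¹)` is compactly supported** for a compactly supported `α` on `GL_n(K ⊗ ℝ)` (★ `hasCompactSupport_iterLieDeriv_glInf` twice; inversion is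
a homeomorphism of `GL_n`). [cite: BorelJacquet1979, §1.5] -/
theorem hasCompactSupport_twoSidedIterLieDeriv_glInf {α : GL (Fin n) (mixedSpace K) → ℂ}
    (hαs : HasCompactSupport α) (u v : List ↥(archGroupGL n K).lie) :
    HasCompactSupport fun x : GL (Fin n) (mixedSpace K) =>
      iterLieDeriv (archGroupGL n K).carrier.subtype u
        (fun y : GL (Fin n) (mixedSpace K) => iterLieDeriv (archGroupGL n K).carrier.subtype v α y⁻¹) x⁻¹ := by
  have h1 : HasCompactSupport (iterLieDeriv (archGroupGL n K).carrier.subtype v α) :=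
    hasCompactSupport_iterLieDeriv_glInf hαs v
  have h2 : HasCompactSupport
      (fun y : GL (Fin n) (mixedSpace K) => iterLieDeriv (archGroupGL n K).carrier.subtype v α y⁻¹) :=
    h1.comp_homeomorph (Homeomorph.inv (GL (Fin n) (mixedSpace K)))
  have h3 : HasCompactSupport (iterLieDeriv (archGroupGL n K).carrier.subtype u
      (fun y : GL (Fin n) (mixedSpace K) => iterLieDeriv (archGroupGL n K).carrier.subtype v α y⁻¹)) :=
    hasCompactSupport_iterLieDeriv_glInf h2 u
  exact h3.comp_homeomorph (Homeomorph.inv (GL (Fin n) (mixedSpace K)))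

end GLn

/-- A continuous compactly supported function pulled back along a closed embedding and multiplied by a continuous real weight is bounded above (a continuous
compactly supported real function has bounded range). [folklore] [cite: BeuzartPlessis2020Asterisque, §1.5 p. 31] -/
theorem exists_bound_norm_comp_mul_of_hasCompactSupport {X Y : Type*} [TopologicalSpace X] [TopologicalSpace Y]
    {E : Type*} [NormedAddCommGroup E] {F : Y → E} (hFc : Continuous F) (hFs : HasCompactSupport F)
    {e : X → Y} (he : IsClosedEmbedding e) {W : X → ℝ} (hW : Continuous W) :
    ∃ C : ℝ, ∀ x : X, ‖F (e x)‖ * W x ≤ C := by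
  have hgc : Continuous fun x : X => ‖F (e x)‖ * W x := ((hFc.comp he.continuous).norm).mul hW
  have hgs : HasCompactSupport fun x : X => ‖F (e x)‖ * W x :=
    ((hFs.comp_isClosedEmbedding he).norm).mul_right (f' := W)
  obtain ⟨C, hC⟩ := hgc.bddAbove_range_of_hasCompactSupport hgs
  exact ⟨C, fun x => hC (Set.mem_range_self x)⟩

/-! ## §2 The endoscopic side `H_∞ = U(Φ₂)(L⁺ ⊗ ℝ) × U(Φ₁)(L⁺ ⊗ ℝ)`: the Hilbert–Schmidt weight and the Schwartz bounds of test functions -/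

section Endo

variable (L : Type) [Field L] [NumberField L] [IsCMField L]

/-- The Hilbert–Schmidt weight `k ↦ ∏_w Σ_{i,j} |(k₂)_{ij,w}|²` of the `U(Φ₂)`-block is continuous on `H_∞` (finitely many continuous matrix entries).
[cite: BeuzartPlessis2020Asterisque, §1.5 Prop. 1.5.1 (i) p. 29] -/
theorem continuous_archHSWeight :
    Continuous fun k : (↥(UnitaryGroup.arch (↥(maximalRealSubfield L)) L (IsCMField.complexConj L) 2
          (Matrix.of fun i j : Fin 2 => if i.val + j.val + 1 = 2 then (1 : L) else 0)) ×
        ↥(UnitaryGroup.arch (↥(maximalRealSubfield L)) L (IsCMField.complexConj L) 1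
          (Matrix.of fun i j : Fin 1 => if i.val + j.val + 1 = 1 then (1 : L) else 0))) =>
      ∏ w : {w : InfinitePlace L // w.IsComplex},
        ∑ i : Fin 2, ∑ j : Fin 2, ‖(((k.1 : GL (Fin 2) (mixedSpace L)) : Matrix (Fin 2) (Fin 2) (mixedSpace L)) i j).2 w‖ ^ 2 := by
  have hval : Continuous fun k : (↥(UnitaryGroup.arch (↥(maximalRealSubfield L)) L (IsCMField.complexConj L) 2
          (Matrix.of fun i j : Fin 2 => if i.val + j.val + 1 = 2 then (1 : L) else 0)) ×
        ↥(UnitaryGroup.arch (↥(maximalRealSubfield L)) L (IsCMField.complexConj L) 1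
          (Matrix.of fun i j : Fin 1 => if i.val + j.val + 1 = 1 then (1 : L) else 0))) =>
      (((k.1 : GL (Fin 2) (mixedSpace L)) : Matrix (Fin 2) (Fin 2) (mixedSpace L))) :=
    Units.continuous_val.comp (continuous_subtype_val.comp continuous_fst)
  refine continuous_finsetProd _ fun w _ => ?_
  refine continuous_finsetSum _ fun i _ => continuous_finsetSum _ fun j _ => ?_
  exact ((continuous_apply w).comp (continuous_snd.comp (hval.matrix_elem i j))).norm.pow 2

/-- The Hilbert–Schmidt weight is POSITIVE: at each complex place `w` the `w`-component of `k₂ ∈ GL₂(L ⊗ ℝ)` has a unit determinant (the image of `det k₂` under the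
place-evaluation ring map `L ⊗ ℝ → ℂ`), so it is not the zero matrix and one summand `|(k₂)_{ij,w}|²` is positive. [cite: BeuzartPlessis2020Asterisque, §1.5 Prop. 1.5.1 (i) p. 29] -/
theorem archHSWeight_pos
    (k : (↥(UnitaryGroup.arch (↥(maximalRealSubfield L)) L (IsCMField.complexConj L) 2
          (Matrix.of fun i j : Fin 2 => if i.val + j.val + 1 = 2 then (1 : L) else 0)) ×
        ↥(UnitaryGroup.arch (↥(maximalRealSubfield L)) L (IsCMField.complexConj L) 1
          (Matrix.of fun i j : Fin 1 => if i.val + j.val + 1 = 1 then (1 : L) else 0)))) :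
    0 < ∏ w : {w : InfinitePlace L // w.IsComplex},
        ∑ i : Fin 2, ∑ j : Fin 2, ‖(((k.1 : GL (Fin 2) (mixedSpace L)) : Matrix (Fin 2) (Fin 2) (mixedSpace L)) i j).2 w‖ ^ 2 := by
  refine Finset.prod_pos fun w _ => ?_
  set M : Matrix (Fin 2) (Fin 2) (mixedSpace L) :=
    (((k.1 : GL (Fin 2) (mixedSpace L)) : Matrix (Fin 2) (Fin 2) (mixedSpace L))) with hM
  let ψ : mixedSpace L →+* ℂ :=
    (Pi.evalRingHom (fun _ : {w : InfinitePlace L // w.IsComplex} => ℂ) w).comp (RingHom.snd _ _)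
  have hdet : IsUnit (ψ.mapMatrix M).det := by
    rw [← RingHom.map_det]
    exact (Matrix.isUnits_det_units (k.1 : GL (Fin 2) (mixedSpace L))).map ψ
  have hM0 : ψ.mapMatrix M ≠ 0 := by
    intro h0
    apply hdet.ne_zero
    rw [h0]
    exact Matrix.det_zero
  obtain ⟨i, j, hij⟩ : ∃ i j, ψ.mapMatrix M i j ≠ 0 := by
    by_contra hall
    push Not at hall
    exact hM0 (Matrix.ext fun i j => by rw [hall i j]; rfl)
  have hij' : (M i j).2 w ≠ 0 := hij
  have hpos : 0 < ‖(M i j).2 w‖ ^ 2 := pow_pos (norm_pos_iff.mpr hij') 2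
  calc (0 : ℝ) < ‖(M i j).2 w‖ ^ 2 := hpos
    _ ≤ ∑ j' : Fin 2, ‖(M i j').2 w‖ ^ 2 :=
        Finset.single_le_sum (f := fun j' : Fin 2 => ‖(M i j').2 w‖ ^ 2) (fun j' _ => by positivity) (Finset.mem_univ j)
    _ ≤ ∑ i' : Fin 2, ∑ j' : Fin 2, ‖(M i' j').2 w‖ ^ 2 :=
        Finset.single_le_sum (f := fun i' : Fin 2 => ∑ j' : Fin 2, ‖(M i' j').2 w‖ ^ 2)
          (fun i' _ => Finset.sum_nonneg fun j' _ => by positivity) (Finset.mem_univ i)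

/-- The Schwartz weight `(∏_w ‖k_{2,w}‖²_{HS})^{1∕2} · (1 + log ∏_w ‖k_{2,w}‖²_{HS})^d` of the skeleton's D1 (its `Ξ⁻¹`- and `σ`-proxies `archXiInv`, `archSigma`) is
continuous on `H_∞` (`√` is continuous; `log` is continuous at the positive argument). [cite: BeuzartPlessis2020Asterisque, §1.5 p. 31] -/
theorem continuous_archSchwartzWeight (d : ℕ) :
    Continuous fun k : (↥(UnitaryGroup.arch (↥(maximalRealSubfield L)) L (IsCMField.complexConj L) 2
          (Matrix.of fun i j : Fin 2 => if i.val + j.val + 1 = 2 then (1 : L) else 0)) ×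
        ↥(UnitaryGroup.arch (↥(maximalRealSubfield L)) L (IsCMField.complexConj L) 1
          (Matrix.of fun i j : Fin 1 => if i.val + j.val + 1 = 1 then (1 : L) else 0))) =>
      Real.sqrt (∏ w : {w : InfinitePlace L // w.IsComplex},
          ∑ i : Fin 2, ∑ j : Fin 2, ‖(((k.1 : GL (Fin 2) (mixedSpace L)) : Matrix (Fin 2) (Fin 2) (mixedSpace L)) i j).2 w‖ ^ 2) *
        (1 + Real.log (∏ w : {w : InfinitePlace L // w.IsComplex},
          ∑ i : Fin 2, ∑ j : Fin 2, ‖(((k.1 : GL (Fin 2) (mixedSpace L)) : Matrix (Fin 2) (Fin 2) (mixedSpace L)) i j).2 w‖ ^ 2)) ^ d :=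
  (Real.continuous_sqrt.comp (continuous_archHSWeight L)).mul
    ((continuous_const.add ((continuous_archHSWeight L).log fun k => (archHSWeight_pos L k).ne')).pow d)

/-- **Two-sided word derivatives of an endoscopic-side test function are bounded against every continuous weight on `H_∞`.**  For `φ` compactly supported and
right-smooth on `GL₃(L ⊗ ℝ)` (the ambient witness of ★ `ArchSmooth₂`), all words `u, v` in `𝔤𝔩₃(L ⊗ ℝ)` and every continuous `W : H_∞ → ℝ`:
`sup_k |(R(u)(R(v)φ)ˇ)((ι_∞ k)⁻¹)| · W(k) < ∞` (§1 + the closed embedding `ι_∞ : H_∞ ↪ GL₃(L ⊗ ℝ)`, ★ `isClosedEmbedding_endoEmbArch`).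
[cite: BeuzartPlessis2020Asterisque, §1.5 p. 31] [cite: Rogawski1990, §14.3 p. 234] -/
theorem exists_bound_twoSidedIterLieDeriv_endoEmbArch {φ : GL (Fin 3) (mixedSpace L) → ℂ}
    (hφ : IsArchSmooth (archGroupGL 3 L).carrier.subtype φ) (hφs : HasCompactSupport φ) (u v : List ↥(archGroupGL 3 L).lie)
    {W : (↥(UnitaryGroup.arch (↥(maximalRealSubfield L)) L (IsCMField.complexConj L) 2
          (Matrix.of fun i j : Fin 2 => if i.val + j.val + 1 = 2 then (1 : L) else 0)) ×
        ↥(UnitaryGroup.arch (↥(maximalRealSubfield L)) L (IsCMField.complexConj L) 1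
          (Matrix.of fun i j : Fin 1 => if i.val + j.val + 1 = 1 then (1 : L) else 0))) → ℝ} (hW : Continuous W) :
    ∃ C : ℝ, ∀ k, ‖iterLieDeriv (archGroupGL 3 L).carrier.subtype u
        (fun y : GL (Fin 3) (mixedSpace L) => iterLieDeriv (archGroupGL 3 L).carrier.subtype v φ y⁻¹)
        ((endoEmbArch L k).val : GL (Fin 3) (mixedSpace L))⁻¹‖ * W k ≤ C :=
  exists_bound_norm_comp_mul_of_hasCompactSupport
    (F := fun x : GL (Fin 3) (mixedSpace L) => iterLieDeriv (archGroupGL 3 L).carrier.subtype u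
        (fun y : GL (Fin 3) (mixedSpace L) => iterLieDeriv (archGroupGL 3 L).carrier.subtype v φ y⁻¹) x⁻¹)
    (continuous_twoSidedIterLieDeriv_glInf hφ u v) (hasCompactSupport_twoSidedIterLieDeriv_glInf hφs u v)
    ((IsClosedEmbedding.subtypeVal (UnitaryGroup.isClosed_arch (↥(maximalRealSubfield L)) L (IsCMField.complexConj L) 3
      (Matrix.of fun i j : Fin 3 => if i.val + j.val + 1 = 3 then (1 : L) else 0))).comp (isClosedEmbedding_endoEmbArch L)) hW

/-- **`C_c^∞(H_∞) ⊂ 𝒞(H_∞)`, over the bodies of the skeleton's D1**: for an endoscopic-side test function `f` (★ `ArchSmooth₂ L f`) there is an ambient right-smooth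
`φ` on `GL₃(L ⊗ ℝ)` with `f = φ ∘ ι_∞` all of whose two-sided word derivatives, pulled back along `ι_∞`, are bounded against the Schwartz weight
`(∏_w ‖k_{2,w}‖²_{HS})^{1∕2} (1 + log ∏_w ‖k_{2,w}‖²_{HS})^d` for every `d` (and every pair of words — the restriction to letters in `𝔥` is not needed).
[cite: BeuzartPlessis2020Asterisque, §1.5 p. 31] [cite: Rogawski1990, §4.9 Prop. 4.9.1 (a) p. 55; §14.3 p. 234] -/
theorem exists_bound_twoSidedIterLieDeriv_endoEmbArch_schwartzWeight
    {f : (↥(UnitaryGroup.arch (↥(maximalRealSubfield L)) L (IsCMField.complexConj L) 2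
          (Matrix.of fun i j : Fin 2 => if i.val + j.val + 1 = 2 then (1 : L) else 0)) ×
        ↥(UnitaryGroup.arch (↥(maximalRealSubfield L)) L (IsCMField.complexConj L) 1
          (Matrix.of fun i j : Fin 1 => if i.val + j.val + 1 = 1 then (1 : L) else 0))) → ℂ}
    (hf : ArchSmooth₂ L f) :
    ∃ φ : GL (Fin 3) (mixedSpace L) → ℂ,
      IsArchSmooth (archGroupGL 3 L).carrier.subtype φ ∧
      (∀ k, f k = φ ((endoEmbArch L k).val : GL (Fin 3) (mixedSpace L))) ∧
      ∀ (u v : List ↥(archGroupGL 3 L).lie) (d : ℕ), ∃ C : ℝ, ∀ k,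
        ‖iterLieDeriv (archGroupGL 3 L).carrier.subtype u
            (fun y : GL (Fin 3) (mixedSpace L) => iterLieDeriv (archGroupGL 3 L).carrier.subtype v φ y⁻¹)
            ((endoEmbArch L k).val : GL (Fin 3) (mixedSpace L))⁻¹‖ *
          Real.sqrt (∏ w : {w : InfinitePlace L // w.IsComplex},
            ∑ i : Fin 2, ∑ j : Fin 2, ‖(((k.1 : GL (Fin 2) (mixedSpace L)) : Matrix (Fin 2) (Fin 2) (mixedSpace L)) i j).2 w‖ ^ 2) *
          (1 + Real.log (∏ w : {w : InfinitePlace L // w.IsComplex},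
            ∑ i : Fin 2, ∑ j : Fin 2, ‖(((k.1 : GL (Fin 2) (mixedSpace L)) : Matrix (Fin 2) (Fin 2) (mixedSpace L)) i j).2 w‖ ^ 2)) ^ d ≤ C := by
  obtain ⟨φ, _hφc, hφs, hφsm, hφf⟩ := hf
  refine ⟨φ, hφsm, hφf, fun u v d => ?_⟩
  obtain ⟨C, hC⟩ := exists_bound_twoSidedIterLieDeriv_endoEmbArch L hφsm hφs u v (continuous_archSchwartzWeight L d)
  exact ⟨C, fun k => by rw [mul_assoc]; exact hC k⟩

end Endo

/-! ## §3 (ED. 2) Any unitary carrier `U(J)(L⁺ ⊗ ℝ) ≤ GL_N(L ⊗ ℝ)`: the full Hilbert–Schmidt weight on `GL_N` and the Schwartz bounds of ★ `ArchSmooth` test functions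

EDITION 2 (append-only; LH3-plan (g0) deals #3∕#4 2026-09-02T02:37:16Z type D1 ONCE over an embedded carrier `ι : X → GL_N(L ⊗ ℝ)` with the weight
`archHSGL g = ∏_w Σ_{i,j} |g_{ij,w}|²` — LH2 (`stub_N8`, `G_∞ = U(Φ₃)_∞`, `G′_∞ = U(H′)_∞`) and LH3 share it).  The twin of §2 for the carriers ★ `UnitaryGroup.arch … N J`
(closed in `GL_N`, ★ `UnitaryGroup.isClosed_arch`) and ★ `ArchSmooth L N J` (restriction of a compactly supported right-smooth `φ`): `C_c^∞(U(J)_∞) ⊂ 𝒞(U(J)_∞)` over the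
bodies of the generic Schwartz class (weights spelled out; every pair of words; every continuous weight). -/

section UnitaryCarrier

variable (L : Type) [Field L] [NumberField L] (N : ℕ)

/-- The full Hilbert–Schmidt weight `g ↦ ∏_w Σ_{i,j} |g_{ij,w}|²` is continuous on `GL_N(L ⊗ ℝ)`. [cite: BeuzartPlessis2020Asterisque, §1.5 Prop. 1.5.1 (i) p. 29] -/
theorem continuous_archHSWeightGL :
    Continuous fun g : GL (Fin N) (mixedSpace L) =>
      ∏ w : {w : InfinitePlace L // w.IsComplex},
        ∑ i : Fin N, ∑ j : Fin N, ‖((g : Matrix (Fin N) (Fin N) (mixedSpace L)) i j).2 w‖ ^ 2 := by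
  have hval : Continuous fun g : GL (Fin N) (mixedSpace L) => (g : Matrix (Fin N) (Fin N) (mixedSpace L)) :=
    Units.continuous_val
  refine continuous_finsetProd _ fun w _ => ?_
  refine continuous_finsetSum _ fun i _ => continuous_finsetSum _ fun j _ => ?_
  exact ((continuous_apply w).comp (continuous_snd.comp (hval.matrix_elem i j))).norm.pow 2

/-- The full Hilbert–Schmidt weight is POSITIVE on `GL_N(L ⊗ ℝ)` for `N ≥ 1`: at each complex place `w` the `w`-component of `g` has a unit determinant, so it is
not the zero matrix. [cite: BeuzartPlessis2020Asterisque, §1.5 Prop. 1.5.1 (i) p. 29] -/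
theorem archHSWeightGL_pos [NeZero N] (g : GL (Fin N) (mixedSpace L)) :
    0 < ∏ w : {w : InfinitePlace L // w.IsComplex},
        ∑ i : Fin N, ∑ j : Fin N, ‖((g : Matrix (Fin N) (Fin N) (mixedSpace L)) i j).2 w‖ ^ 2 := by
  refine Finset.prod_pos fun w _ => ?_
  set M : Matrix (Fin N) (Fin N) (mixedSpace L) := (g : Matrix (Fin N) (Fin N) (mixedSpace L)) with hM
  let ψ : mixedSpace L →+* ℂ :=
    (Pi.evalRingHom (fun _ : {w : InfinitePlace L // w.IsComplex} => ℂ) w).comp (RingHom.snd _ _)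
  have hdet : IsUnit (ψ.mapMatrix M).det := by
    rw [← RingHom.map_det]
    exact (Matrix.isUnits_det_units g).map ψ
  have hM0 : ψ.mapMatrix M ≠ 0 := by
    intro h0
    apply hdet.ne_zero
    rw [h0]
    exact Matrix.det_zero
  obtain ⟨i, j, hij⟩ : ∃ i j, ψ.mapMatrix M i j ≠ 0 := by
    by_contra hall
    push Not at hall
    exact hM0 (Matrix.ext fun i j => by rw [hall i j]; rfl)
  have hij' : (M i j).2 w ≠ 0 := hij
  have hpos : 0 < ‖(M i j).2 w‖ ^ 2 := pow_pos (norm_pos_iff.mpr hij') 2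
  calc (0 : ℝ) < ‖(M i j).2 w‖ ^ 2 := hpos
    _ ≤ ∑ j' : Fin N, ‖(M i j').2 w‖ ^ 2 :=
        Finset.single_le_sum (f := fun j' : Fin N => ‖(M i j').2 w‖ ^ 2) (fun j' _ => by positivity) (Finset.mem_univ j)
    _ ≤ ∑ i' : Fin N, ∑ j' : Fin N, ‖(M i' j').2 w‖ ^ 2 :=
        Finset.single_le_sum (f := fun i' : Fin N => ∑ j' : Fin N, ‖(M i' j').2 w‖ ^ 2)
          (fun i' _ => Finset.sum_nonneg fun j' _ => by positivity) (Finset.mem_univ i)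

/-- The generic Schwartz weight `(∏_w Σ|g_{ij,w}|²)^{1∕2} · (1 + log ∏_w Σ|g_{ij,w}|²)^d` is continuous on `GL_N(L ⊗ ℝ)`, `N ≥ 1`.
[cite: BeuzartPlessis2020Asterisque, §1.5 p. 31] -/
theorem continuous_archSchwartzWeightGL [NeZero N] (d : ℕ) :
    Continuous fun g : GL (Fin N) (mixedSpace L) =>
      Real.sqrt (∏ w : {w : InfinitePlace L // w.IsComplex},
          ∑ i : Fin N, ∑ j : Fin N, ‖((g : Matrix (Fin N) (Fin N) (mixedSpace L)) i j).2 w‖ ^ 2) *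
        (1 + Real.log (∏ w : {w : InfinitePlace L // w.IsComplex},
          ∑ i : Fin N, ∑ j : Fin N, ‖((g : Matrix (Fin N) (Fin N) (mixedSpace L)) i j).2 w‖ ^ 2)) ^ d :=
  (Real.continuous_sqrt.comp (continuous_archHSWeightGL L N)).mul
    ((continuous_const.add ((continuous_archHSWeightGL L N).log fun g => (archHSWeightGL_pos L N g).ne')).pow d)

variable [IsCMField L] (J : Matrix (Fin N) (Fin N) L)

/-- **Two-sided word derivatives of a test function on `U(J)(L⁺ ⊗ ℝ)` are bounded against every continuous weight on `U(J)(L⁺ ⊗ ℝ)`**: for `φ` compactly supported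
and right-smooth on `GL_N(L ⊗ ℝ)`, all words `u, v` and every continuous `W : U(J)_∞ → ℝ` (the carrier ★ `UnitaryGroup.arch … N J` is closed in `GL_N`, ★ `isClosed_arch`).
[cite: BeuzartPlessis2020Asterisque, §1.5 p. 31] [cite: Rogawski1990, §14.2 p. 233] -/
theorem exists_bound_twoSidedIterLieDeriv_arch {φ : GL (Fin N) (mixedSpace L) → ℂ}
    (hφ : IsArchSmooth (archGroupGL N L).carrier.subtype φ) (hφs : HasCompactSupport φ) (u v : List ↥(archGroupGL N L).lie)
    {W : ↥(UnitaryGroup.arch (↥(maximalRealSubfield L)) L (IsCMField.complexConj L) N J) → ℝ} (hW : Continuous W) :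
    ∃ C : ℝ, ∀ g : ↥(UnitaryGroup.arch (↥(maximalRealSubfield L)) L (IsCMField.complexConj L) N J),
      ‖iterLieDeriv (archGroupGL N L).carrier.subtype u
          (fun y : GL (Fin N) (mixedSpace L) => iterLieDeriv (archGroupGL N L).carrier.subtype v φ y⁻¹)
          (g : GL (Fin N) (mixedSpace L))⁻¹‖ * W g ≤ C :=
  exists_bound_norm_comp_mul_of_hasCompactSupport
    (F := fun x : GL (Fin N) (mixedSpace L) => iterLieDeriv (archGroupGL N L).carrier.subtype u
        (fun y : GL (Fin N) (mixedSpace L) => iterLieDeriv (archGroupGL N L).carrier.subtype v φ y⁻¹) x⁻¹)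
    (continuous_twoSidedIterLieDeriv_glInf hφ u v) (hasCompactSupport_twoSidedIterLieDeriv_glInf hφs u v)
    (IsClosedEmbedding.subtypeVal (UnitaryGroup.isClosed_arch (↥(maximalRealSubfield L)) L (IsCMField.complexConj L) N J)) hW

/-- **`C_c^∞(U(J)_∞) ⊂ 𝒞(U(J)_∞)`, over the bodies of the generic Schwartz class**: a test function `f` on `U(J)(L⁺ ⊗ ℝ)` (★ `ArchSmooth L N J f`) is the
restriction of a right-smooth `φ` on `GL_N(L ⊗ ℝ)` all of whose two-sided word derivatives, restricted to `U(J)_∞`, are bounded against the generic Schwartz weight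
`(∏_w Σ|g_{ij,w}|²)^{1∕2} (1 + log ∏_w Σ|g_{ij,w}|²)^d` for every `d` and every pair of words (`N ≥ 1`). [cite: BeuzartPlessis2020Asterisque, §1.5 p. 31]
[cite: Rogawski1990, §14.2 p. 233; §4.9 Prop. 4.9.1 (a) p. 55] -/
theorem exists_bound_twoSidedIterLieDeriv_arch_schwartzWeightGL [NeZero N]
    {f : ↥(UnitaryGroup.arch (↥(maximalRealSubfield L)) L (IsCMField.complexConj L) N J) → ℂ} (hf : ArchSmooth L N J f) :
    ∃ φ : GL (Fin N) (mixedSpace L) → ℂ,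
      IsArchSmooth (archGroupGL N L).carrier.subtype φ ∧
      (∀ g : ↥(UnitaryGroup.arch (↥(maximalRealSubfield L)) L (IsCMField.complexConj L) N J), f g = φ (g : GL (Fin N) (mixedSpace L))) ∧
      ∀ (u v : List ↥(archGroupGL N L).lie) (d : ℕ), ∃ C : ℝ,
        ∀ g : ↥(UnitaryGroup.arch (↥(maximalRealSubfield L)) L (IsCMField.complexConj L) N J),
          ‖iterLieDeriv (archGroupGL N L).carrier.subtype u
              (fun y : GL (Fin N) (mixedSpace L) => iterLieDeriv (archGroupGL N L).carrier.subtype v φ y⁻¹)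
              (g : GL (Fin N) (mixedSpace L))⁻¹‖ *
            Real.sqrt (∏ w : {w : InfinitePlace L // w.IsComplex},
              ∑ i : Fin N, ∑ j : Fin N, ‖(((g : GL (Fin N) (mixedSpace L)) : Matrix (Fin N) (Fin N) (mixedSpace L)) i j).2 w‖ ^ 2) *
            (1 + Real.log (∏ w : {w : InfinitePlace L // w.IsComplex},
              ∑ i : Fin N, ∑ j : Fin N, ‖(((g : GL (Fin N) (mixedSpace L)) : Matrix (Fin N) (Fin N) (mixedSpace L)) i j).2 w‖ ^ 2)) ^ d ≤ C := by
  obtain ⟨φ, _hφc, hφs, hφsm, hφf⟩ := hf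
  refine ⟨φ, hφsm, hφf, fun u v d => ?_⟩
  obtain ⟨C, hC⟩ := exists_bound_twoSidedIterLieDeriv_arch L N J hφsm hφs u v
    ((continuous_archSchwartzWeightGL L N d).comp continuous_subtype_val)
  exact ⟨C, fun g => by rw [mul_assoc]; exact hC g⟩

end UnitaryCarrier

/-! ## §4 (ED. 3) BY NAME over ★ `ArchSchwartzSpace` (p848256): `C_c^∞ ⊆ 𝒞` for `ArchSchwartzGL` ∕ `ArchSchwartzOn`, every letter set `𝔩`, every `Ξ`-exponent `e`

EDITION 3 (append-only; LH3-plan (g0) RE-BASING RULE 2026-09-02T02:50:28Z «state everything over LITERATURE names, never over the leaf's §0»).  The §2∕§3 bounds hold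
against EVERY continuous weight, so the inclusions below hold for every exponent `e : ℝ` (the tabulated `e = 1∕2` for `H_∞`, `e = 1` for `U(2,1)`-type carriers) and
every letter set `𝔩` (the `𝔩`-hypotheses of ★ `ArchSchwartzGL` are not used). -/

section ByName

variable (L : Type) [Field L] [NumberField L] (N : ℕ)

/-- ★ `archHSGL L N` is continuous on `GL_N(L ⊗ ℝ)` (§3 `continuous_archHSWeightGL` by name). [cite: BeuzartPlessis2020Asterisque, §1.5 Prop. 1.5.1 (i) p. 29] -/
theorem continuous_archHSGL : Continuous (archHSGL L N) := by
  unfold archHSGL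
  exact continuous_archHSWeightGL L N

/-- ★ `archHSGL L N g > 0` for `N ≥ 1` (§3 `archHSWeightGL_pos` by name). [cite: BeuzartPlessis2020Asterisque, §1.5 Prop. 1.5.1 (i) p. 29] -/
theorem archHSGL_pos_of_neZero [NeZero N] (g : GL (Fin N) (mixedSpace L)) : 0 < archHSGL L N g := by
  unfold archHSGL
  exact archHSWeightGL_pos L N g

/-- The weight `archHSGL ^ e · (1 + log archHSGL) ^ d` of ★ `ArchSchwartzGL` is continuous on `GL_N(L ⊗ ℝ)` for every real exponent `e` (`N ≥ 1`: the base is positive).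
[cite: BeuzartPlessis2020Asterisque, §1.5 p. 31] -/
theorem continuous_archSchwartzGLWeight [NeZero N] (e : ℝ) (d : ℕ) :
    Continuous fun g : GL (Fin N) (mixedSpace L) => archHSGL L N g ^ e * (1 + Real.log (archHSGL L N g)) ^ d :=
  ((continuous_archHSGL L N).rpow_const fun g => Or.inl (archHSGL_pos_of_neZero L N g).ne').mul
    ((continuous_const.add ((continuous_archHSGL L N).log fun g => (archHSGL_pos_of_neZero L N g).ne')).pow d)

variable [IsCMField L] (J : Matrix (Fin N) (Fin N) L)

/-- **`C_c^∞(U(J)_∞) ⊆ 𝒞(U(J)_∞)` BY NAME, for every letter set and every `Ξ`-exponent**: a test function on `U(J)(L⁺ ⊗ ℝ)` (★ `ArchSmooth L N J f`) lies in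
★ `ArchSchwartzGL L N 𝔩 e (↑) f` (§3 `exists_bound_twoSidedIterLieDeriv_arch` against the continuous weight `archHSGL ^ e (1 + log archHSGL)^d`; `N ≥ 1`).
[cite: BeuzartPlessis2020Asterisque, §1.5 p. 31] [cite: Rogawski1990, §14.2 p. 233] -/
theorem archSchwartzGL_subtypeVal_of_archSmooth [NeZero N] (𝔩 : Set (Matrix (Fin N) (Fin N) (mixedSpace L))) (e : ℝ)
    {f : ↥(UnitaryGroup.arch (↥(maximalRealSubfield L)) L (IsCMField.complexConj L) N J) → ℂ} (hf : ArchSmooth L N J f) :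
    ArchSchwartzGL L N 𝔩 e
      (fun g : ↥(UnitaryGroup.arch (↥(maximalRealSubfield L)) L (IsCMField.complexConj L) N J) => (g : GL (Fin N) (mixedSpace L))) f := by
  obtain ⟨φ, _hφc, hφs, hφsm, hφf⟩ := hf
  refine ⟨φ, hφsm, hφf, fun u v _ _ d => ?_⟩
  obtain ⟨C, hC⟩ := exists_bound_twoSidedIterLieDeriv_arch L N J hφsm hφs u v
    ((continuous_archSchwartzGLWeight L N e d).comp continuous_subtype_val)
  exact ⟨C, fun g => by rw [mul_assoc]; exact hC g⟩

/-- **`C_c^∞(U(J)_∞) ⊆ 𝒞(U(J)_∞)` = ★ `ArchSmooth L N J f → ArchSchwartzOn L N J e f`** (every `e`; LH2's certificate «O1″ not stronger than `stub_N8`» at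
`G_∞ = U(Φ₃)_∞`, `G′_∞ = U(H′)_∞`, `e = 1`). [cite: BeuzartPlessis2020Asterisque, §1.5 p. 31] [cite: Rogawski1990, §14.2 p. 233; §4.9 Prop. 4.9.1 (a) p. 55] -/
theorem archSchwartzOn_of_archSmooth [NeZero N] (e : ℝ)
    {f : ↥(UnitaryGroup.arch (↥(maximalRealSubfield L)) L (IsCMField.complexConj L) N J) → ℂ} (hf : ArchSmooth L N J f) :
    ArchSchwartzOn L N J e f :=
  archSchwartzGL_subtypeVal_of_archSmooth L N J _ e hf

/-- **`C_c^∞(H_∞) ⊆ 𝒞(H_∞)` BY NAME on the endoscopic side, for every letter set and every `Ξ`-exponent**: an endoscopic-side test function (★ `ArchSmooth₂ L f`) lies in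
★ `ArchSchwartzGL L 3 𝔩 e (fun k => (ι_∞ k).val) f` (§2 `exists_bound_twoSidedIterLieDeriv_endoEmbArch`; at `𝔩 = 𝔥`, `e = 1∕2` this is LH3's `ArchSchwartzEndo` ∕ the
leaf's D1 through ★ `archSchwartzGL_half_endoEmbArch_iff`). [cite: BeuzartPlessis2020Asterisque, §1.5 p. 31] [cite: Rogawski1990, §14.3 p. 234] -/
theorem archSchwartzGL_endoEmbArch_of_archSmooth₂ (𝔩 : Set (Matrix (Fin 3) (Fin 3) (mixedSpace L))) (e : ℝ)
    {f : (↥(UnitaryGroup.arch (↥(maximalRealSubfield L)) L (IsCMField.complexConj L) 2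
          (Matrix.of fun i j : Fin 2 => if i.val + j.val + 1 = 2 then (1 : L) else 0)) ×
        ↥(UnitaryGroup.arch (↥(maximalRealSubfield L)) L (IsCMField.complexConj L) 1
          (Matrix.of fun i j : Fin 1 => if i.val + j.val + 1 = 1 then (1 : L) else 0))) → ℂ}
    (hf : ArchSmooth₂ L f) :
    ArchSchwartzGL L 3 𝔩 e (fun k => ((endoEmbArch L k).val : GL (Fin 3) (mixedSpace L))) f := by
  obtain ⟨φ, _hφc, hφs, hφsm, hφf⟩ := hf
  refine ⟨φ, hφsm, hφf, fun u v _ _ d => ?_⟩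
  obtain ⟨C, hC⟩ := exists_bound_twoSidedIterLieDeriv_endoEmbArch L hφsm hφs u v
    ((continuous_archSchwartzGLWeight L 3 e d).comp (continuous_subtype_val.comp (continuous_endoEmbArch L)))
  exact ⟨C, fun k => by rw [mul_assoc]; exact hC k⟩

end ByName

end Literature.NumberTheory.Rogawski1990

end
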